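import Summits.CriticalPhenomena.PercolationContinuityZ3.Theorems.PercNearOneGluingNoHeavyQuantHeavyShift
import HarnessLib

/-!
# QUANT lane R8, T-DEC: A FIVE-ATOM LAW `{0, k, 2k, 3k, 4k}` OF MEAN `s·k` IS HEAVY-DEC AT FLOOR `s/4` — regimes `s ≤ 1`, `1 < s ≤ 2`,
# `2 < s ≤ 8/3`, `8/3 ≤ s < 3`, `3 ≤ s < 4` (explicit heavy decompositions; the four-blob case of the average-floor lift) (prim-quant-census-2 gen 80)

builds on p205010 (kernel theorem, internal audit signed; external expert review pending)

Support file (`--supports stmt-CriticalPhenomena-4575`), QUANT lane census seat prim-quant-census-2 (gen 80); memo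
`run/shared/lean/prim/quant/prim-quant-census-2-g80/TRIPLE-G80.md` §5.  Theorems only, standard axioms, no sorries, no definitions.  The width-4
analogue of `…QuantFourAtomsHeavy`: an abstract law `p₀δ₀ + p₁δ_k + p₂δ_{2k} + p₃δ_{3k} + p₄δ_{4k}` (`pᵢ ≥ 0`, `Σ pᵢ = 1`, `p₁+2p₂+3p₃+4p₄ = s`) carries
a HEAVY decomposition (pairs with gate `≥ s/4` and credit `≥ s·k`, self-sufficient points; inline `∃` as in `…QuantHeavyShift`) at floor `s/4`, target
`s·k`.  The only lows are `0` and (for `s > 2`) `k`.  `s ≤ 1`: the zero ships to `k,2k,3k,4k` at the credit gates `s/b`, exactly; `1 < s ≤ 2`: `k` stands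
alone, the zero ships to `2k,3k,4k`; `2 < s ≤ 8/3`: `k → 2k` at the floor gate, zero → `4k` then `3k` (gate `s/3`); `8/3 ≤ s < 3`: `k → 2k` at gate `s−2`
then `3k`, zero → `4k` then `3k`; `3 ≤ s < 4`: zero → `4k`, `k → 3k`.  The capacity hypotheses of the last three regimes are stated explicitly; for the
four-blob weights they are polynomial inequalities in `(c, g)` (`…QuantFourBlobAverageFloor`).

HONEST STATUS.  Tools; `SiblingStep`, `FarTreeRow` OPEN; RATE class (log\*) / honest sentence of `run/shared/lean/prim/quant/README.md` unchanged.
[this work].  Nothing here is cited as a published result.  The gluing rows served [cite: KozmaNitzan2024, Conjecture 3 (p. 15)]; product measure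
[cite: Grimmett1999, §1.3 p. 10].
-/

noncomputable section

open scoped BigOperators

namespace Summit.CriticalPhenomena.PercolationContinuityZ3.Theorems
namespace Quant

open Finset

/-- the two-point law `{lo, hi; g}` (as in `…QuantLawDEC`) -/
local notation3 "TP[" lo ", " hi ", " g ", " h "]" =>
  (g : ℝ) * (if (h : ℕ) = (hi : ℕ) then (1 : ℝ) else 0) + (1 - (g : ℝ)) * (if (h : ℕ) = (lo : ℕ) then (1 : ℝ) else 0)

namespace LawDec

/-! ### Regime `s ≤ 1` -/

/-- regime `s ≤ 1`: the zero atom ships to `k, 2k, 3k, 4k` at the credit gates `s, s/2, s/3, s/4` — exactly. [this work] -/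
theorem heavy_fiveAtoms_r1 (k : ℕ) (p₀ p₁ p₂ p₃ p₄ s : ℝ) (hp₀0 : 0 ≤ p₀) (hp₁0 : 0 ≤ p₁) (hp₂0 : 0 ≤ p₂)
    (hp₃0 : 0 ≤ p₃) (hp₄0 : 0 ≤ p₄) (hsum : p₀ + p₁ + p₂ + p₃ + p₄ = 1) (hmean : p₁ + 2 * p₂ + 3 * p₃ + 4 * p₄ = s) (hs0 : 0 < s) (h1 : s ≤ 1) :
    ∃ (ι : Type) (_ : Fintype ι) (lam γ : ι → ℝ) (lo hi : ι → ℕ),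
      (∀ i, 0 ≤ lam i) ∧ (∑ i, lam i = 1) ∧ (∀ i, 0 ≤ γ i ∧ γ i ≤ 1) ∧ (∀ i, lo i ≤ hi i) ∧ (∀ i, hi i ≤ 4 * k) ∧
      (∀ h, (p₀ * (if h = 0 then (1 : ℝ) else 0) + p₁ * (if h = k then (1 : ℝ) else 0) + p₂ * (if h = 2 * k then (1 : ℝ) else 0)
          + p₃ * (if h = 3 * k then (1 : ℝ) else 0) + p₄ * (if h = 4 * k then (1 : ℝ) else 0)) = ∑ i, lam i * TP[lo i, hi i, γ i, h]) ∧
      (∀ i, 0 < lam i → s / 4 ≤ γ i ∧ s * k ≤ 2 * (lo i : ℝ) + ((hi i : ℝ) - lo i) * γ i) := by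
  have hk0 : (0 : ℝ) ≤ k := Nat.cast_nonneg k
  have hsne : s ≠ 0 := hs0.ne'
  have c2k : ((2 * k : ℕ) : ℝ) = 2 * (k : ℝ) := by push_cast; ring
  have c3k : ((3 * k : ℕ) : ℝ) = 3 * (k : ℝ) := by push_cast; ring
  have c4k : ((4 * k : ℕ) : ℝ) = 4 * (k : ℝ) := by push_cast; ring
  have hγ₂0 : 0 < s / 2 := by positivity
  have hγ₃0 : 0 < s / 3 := by positivity
  have hγ₄0 : 0 < s / 4 := by positivity
  refine ⟨Fin 4, inferInstance, ![p₁ / s, p₂ / (s / 2), p₃ / (s / 3), p₄ / (s / 4)], ![s, s / 2, s / 3, s / 4], ![0, 0, 0, 0],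
    ![k, 2 * k, 3 * k, 4 * k], ?_, ?_, ?_, ?_, ?_, fun h => ?_, ?_⟩
  · intro i; fin_cases i
    · exact div_nonneg hp₁0 hs0.le
    · exact div_nonneg hp₂0 hγ₂0.le
    · exact div_nonneg hp₃0 hγ₃0.le
    · exact div_nonneg hp₄0 hγ₄0.le
  · rw [Fin.sum_univ_four]
    show p₁ / s + p₂ / (s / 2) + p₃ / (s / 3) + p₄ / (s / 4) = 1
    have e : p₁ / s + p₂ / (s / 2) + p₃ / (s / 3) + p₄ / (s / 4) = (p₁ + 2 * p₂ + 3 * p₃ + 4 * p₄) / s := by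
      field_simp
    rw [e, hmean, div_self hs0.ne']
  · intro i; fin_cases i
    · exact ⟨hs0.le, h1⟩
    · exact ⟨hγ₂0.le, by show s / 2 ≤ 1; linarith⟩
    · exact ⟨hγ₃0.le, by show s / 3 ≤ 1; linarith⟩
    · exact ⟨hγ₄0.le, by show s / 4 ≤ 1; linarith⟩
  · intro i; fin_cases i <;> exact Nat.zero_le _
  · intro i; fin_cases i
    · show k ≤ 4 * k; omega
    · show 2 * k ≤ 4 * k; omega
    · show 3 * k ≤ 4 * k; omega
    · exact le_rfl
  · rw [Fin.sum_univ_four]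
    show _ = p₁ / s * TP[0, k, s, h] + p₂ / (s / 2) * TP[0, 2 * k, s / 2, h] + p₃ / (s / 3) * TP[0, 3 * k, s / 3, h]
      + p₄ / (s / 4) * TP[0, 4 * k, s / 4, h]
    have e1 : p₁ / s * s = p₁ := div_mul_cancel₀ p₁ hs0.ne'
    have e2 : p₂ / (s / 2) * (s / 2) = p₂ := div_mul_cancel₀ p₂ hγ₂0.ne'
    have e3 : p₃ / (s / 3) * (s / 3) = p₃ := div_mul_cancel₀ p₃ hγ₃0.ne'
    have e4 : p₄ / (s / 4) * (s / 4) = p₄ := div_mul_cancel₀ p₄ hγ₄0.ne'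
    have e0 : p₁ / s * (1 - s) + p₂ / (s / 2) * (1 - s / 2) + p₃ / (s / 3) * (1 - s / 3) + p₄ / (s / 4) * (1 - s / 4) = p₀ := by
      have : p₁ / s * (1 - s) + p₂ / (s / 2) * (1 - s / 2) + p₃ / (s / 3) * (1 - s / 3) + p₄ / (s / 4) * (1 - s / 4)
          = (p₁ + 2 * p₂ + 3 * p₃ + 4 * p₄) / s - (p₁ + p₂ + p₃ + p₄) := by field_simp; ring
      rw [this, hmean, div_self hs0.ne']; linarith
    linear_combination (-(if h = k then (1 : ℝ) else 0)) * e1 - (if h = 2 * k then (1 : ℝ) else 0) * e2 - (if h = 3 * k then (1 : ℝ) else 0) * e3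
      - (if h = 4 * k then (1 : ℝ) else 0) * e4 - (if h = 0 then (1 : ℝ) else 0) * e0
  · intro i hi
    clear hi
    fin_cases i
    · show s / 4 ≤ s ∧ s * k ≤ 2 * ((0 : ℕ) : ℝ) + ((k : ℝ) - ((0 : ℕ) : ℝ)) * s
      push_cast
      exact ⟨by linarith, by linarith⟩
    · show s / 4 ≤ s / 2 ∧ s * k ≤ 2 * ((0 : ℕ) : ℝ) + (((2 * k : ℕ) : ℝ) - ((0 : ℕ) : ℝ)) * (s / 2)
      rw [c2k]; push_cast
      exact ⟨by linarith, by linarith⟩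
    · show s / 4 ≤ s / 3 ∧ s * k ≤ 2 * ((0 : ℕ) : ℝ) + (((3 * k : ℕ) : ℝ) - ((0 : ℕ) : ℝ)) * (s / 3)
      rw [c3k]; push_cast
      exact ⟨by linarith, by linarith⟩
    · show s / 4 ≤ s / 4 ∧ s * k ≤ 2 * ((0 : ℕ) : ℝ) + (((4 * k : ℕ) : ℝ) - ((0 : ℕ) : ℝ)) * (s / 4)
      rw [c4k]; push_cast
      exact ⟨le_rfl, by linarith⟩

/-! ### Regime `1 < s ≤ 2` -/

/-- regime `1 < s ≤ 2`: `k` stands alone; the zero ships to `2k, 3k, 4k` at the gates `s/2, s/3, s/4` (slack `p₁(s−1)/s`). [this work] -/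
theorem heavy_fiveAtoms_r2 (k : ℕ) (p₀ p₁ p₂ p₃ p₄ s : ℝ) (hp₀0 : 0 ≤ p₀) (hp₁0 : 0 ≤ p₁) (hp₂0 : 0 ≤ p₂)
    (hp₃0 : 0 ≤ p₃) (hp₄0 : 0 ≤ p₄) (hsum : p₀ + p₁ + p₂ + p₃ + p₄ = 1) (hmean : p₁ + 2 * p₂ + 3 * p₃ + 4 * p₄ = s) (hs0 : 0 < s) (h1 : 1 < s) (h2 : s ≤ 2) :
    ∃ (ι : Type) (_ : Fintype ι) (lam γ : ι → ℝ) (lo hi : ι → ℕ),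
      (∀ i, 0 ≤ lam i) ∧ (∑ i, lam i = 1) ∧ (∀ i, 0 ≤ γ i ∧ γ i ≤ 1) ∧ (∀ i, lo i ≤ hi i) ∧ (∀ i, hi i ≤ 4 * k) ∧
      (∀ h, (p₀ * (if h = 0 then (1 : ℝ) else 0) + p₁ * (if h = k then (1 : ℝ) else 0) + p₂ * (if h = 2 * k then (1 : ℝ) else 0)
          + p₃ * (if h = 3 * k then (1 : ℝ) else 0) + p₄ * (if h = 4 * k then (1 : ℝ) else 0)) = ∑ i, lam i * TP[lo i, hi i, γ i, h]) ∧
      (∀ i, 0 < lam i → s / 4 ≤ γ i ∧ s * k ≤ 2 * (lo i : ℝ) + ((hi i : ℝ) - lo i) * γ i) := by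
  have hk0 : (0 : ℝ) ≤ k := Nat.cast_nonneg k
  have hsne : s ≠ 0 := hs0.ne'
  have c2k : ((2 * k : ℕ) : ℝ) = 2 * (k : ℝ) := by push_cast; ring
  have c3k : ((3 * k : ℕ) : ℝ) = 3 * (k : ℝ) := by push_cast; ring
  have c4k : ((4 * k : ℕ) : ℝ) = 4 * (k : ℝ) := by push_cast; ring
  obtain ⟨x, hx⟩ : ∃ x : ℝ, x = s / 4 := ⟨_, rfl⟩
  have hx0 : 0 < x := by rw [hx]; positivity
  have hx1 : x < 1 := by rw [hx]; linarith
  have hxne : x ≠ 0 := hx0.ne'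
  have hγ₂0 : 0 < s / 2 := by positivity
  have hγ₂1 : s / 2 ≤ 1 := by linarith
  have hγ₃0 : 0 < s / 3 := by positivity
  have hγ₃1 : s / 3 ≤ 1 := by linarith
  have hγ₃ne : s / 3 ≠ 0 := hγ₃0.ne'
  obtain ⟨D, hD⟩ : ∃ D : ℝ, D = p₂ / (s / 2) * (1 - s / 2) + p₃ / (s / 3) * (1 - s / 3) + p₄ / x * (1 - x) := ⟨_, rfl⟩
  have hsD : s * D = 2 * p₂ + 3 * p₃ + 4 * p₄ - s * (p₂ + p₃ + p₄) := by rw [hD, hx]; field_simp; ring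
  have hDp : s * (D - p₀) = p₁ * (s - 1) := by linear_combination hsD + hmean - s * hsum
  have hDp0 : p₀ ≤ D := by
    have h' : s * p₀ ≤ s * D := by nlinarith [mul_nonneg hp₁0 (by linarith : (0 : ℝ) ≤ s - 1)]
    exact le_of_mul_le_mul_left h' hs0
  have hD0 : 0 ≤ D := hp₀0.trans hDp0
  obtain ⟨t, ht0, ht1, htD⟩ : ∃ t : ℝ, 0 ≤ t ∧ t ≤ 1 ∧ t * D = p₀ := by
    rcases hD0.eq_or_lt with hz | hz
    · refine ⟨0, le_rfl, zero_le_one, ?_⟩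
      rw [zero_mul]; linarith [hz ▸ hDp0]
    · exact ⟨p₀ / D, div_nonneg hp₀0 hD0, (div_le_one hz).2 hDp0, div_mul_cancel₀ p₀ hz.ne'⟩
  obtain ⟨l₂, hl₂⟩ : ∃ l : ℝ, l = t * (p₂ / (s / 2)) := ⟨_, rfl⟩
  obtain ⟨l₃, hl₃⟩ : ∃ l : ℝ, l = t * (p₃ / (s / 3)) := ⟨_, rfl⟩
  obtain ⟨l₄, hl₄⟩ : ∃ l : ℝ, l = t * (p₄ / x) := ⟨_, rfl⟩
  have el₂ : l₂ * (s / 2) = t * p₂ := by rw [hl₂]; field_simp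
  have el₃ : l₃ * (s / 3) = t * p₃ := by rw [hl₃]; field_simp
  have el₄ : l₄ * x = t * p₄ := by rw [hl₄]; field_simp
  have e0 : l₂ * (1 - s / 2) + l₃ * (1 - s / 3) + l₄ * (1 - x) = p₀ := by rw [← htD, hl₂, hl₃, hl₄, hD]; ring
  refine ⟨Fin 7, inferInstance, ![l₂, l₃, l₄, p₁, (1 - t) * p₂, (1 - t) * p₃, (1 - t) * p₄], ![s / 2, s / 3, x, 1, 1, 1, 1],
    ![0, 0, 0, k, 2 * k, 3 * k, 4 * k], ![2 * k, 3 * k, 4 * k, k, 2 * k, 3 * k, 4 * k], ?_, ?_, ?_, ?_, ?_, fun h => ?_, ?_⟩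
  · intro i; fin_cases i
    · show 0 ≤ l₂; rw [hl₂]; exact mul_nonneg ht0 (div_nonneg hp₂0 hγ₂0.le)
    · show 0 ≤ l₃; rw [hl₃]; exact mul_nonneg ht0 (div_nonneg hp₃0 hγ₃0.le)
    · show 0 ≤ l₄; rw [hl₄]; exact mul_nonneg ht0 (div_nonneg hp₄0 hx0.le)
    · exact hp₁0
    · exact mul_nonneg (by linarith) hp₂0
    · exact mul_nonneg (by linarith) hp₃0
    · exact mul_nonneg (by linarith) hp₄0
  · rw [Fin.sum_univ_seven]
    show l₂ + l₃ + l₄ + p₁ + (1 - t) * p₂ + (1 - t) * p₃ + (1 - t) * p₄ = 1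
    have e : l₂ + l₃ + l₄ = t * D + t * (p₂ + p₃ + p₄) := by
      rw [hl₂, hl₃, hl₄, hD]; field_simp; ring
    linear_combination e + htD + hsum
  · intro i; fin_cases i
    · exact ⟨hγ₂0.le, hγ₂1⟩
    · exact ⟨hγ₃0.le, hγ₃1⟩
    · exact ⟨hx0.le, hx1.le⟩
    · exact ⟨zero_le_one, le_rfl⟩
    · exact ⟨zero_le_one, le_rfl⟩
    · exact ⟨zero_le_one, le_rfl⟩
    · exact ⟨zero_le_one, le_rfl⟩
  · intro i; fin_cases i
    · exact Nat.zero_le _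
    · exact Nat.zero_le _
    · exact Nat.zero_le _
    · exact le_rfl
    · exact le_rfl
    · exact le_rfl
    · exact le_rfl
  · intro i; fin_cases i
    · show 2 * k ≤ 4 * k; omega
    · show 3 * k ≤ 4 * k; omega
    · exact le_rfl
    · show k ≤ 4 * k; omega
    · show 2 * k ≤ 4 * k; omega
    · show 3 * k ≤ 4 * k; omega
    · exact le_rfl
  · rw [Fin.sum_univ_seven]
    show _ = l₂ * TP[0, 2 * k, s / 2, h] + l₃ * TP[0, 3 * k, s / 3, h] + l₄ * TP[0, 4 * k, x, h] + p₁ * TP[k, k, (1 : ℝ), h]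
      + (1 - t) * p₂ * TP[2 * k, 2 * k, (1 : ℝ), h] + (1 - t) * p₃ * TP[3 * k, 3 * k, (1 : ℝ), h]
      + (1 - t) * p₄ * TP[4 * k, 4 * k, (1 : ℝ), h]
    linear_combination (-(if h = 0 then (1 : ℝ) else 0)) * e0 - (if h = 2 * k then (1 : ℝ) else 0) * el₂ - (if h = 3 * k then (1 : ℝ) else 0) * el₃
      - (if h = 4 * k then (1 : ℝ) else 0) * el₄
  · intro i hi
    clear hi
    have hsk2 : s * (k : ℝ) ≤ 2 * k := mul_le_mul_of_nonneg_right h2 hk0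
    fin_cases i
    · show s / 4 ≤ s / 2 ∧ s * k ≤ 2 * ((0 : ℕ) : ℝ) + (((2 * k : ℕ) : ℝ) - ((0 : ℕ) : ℝ)) * (s / 2)
      rw [c2k]; push_cast
      exact ⟨by linarith, by linarith⟩
    · show s / 4 ≤ s / 3 ∧ s * k ≤ 2 * ((0 : ℕ) : ℝ) + (((3 * k : ℕ) : ℝ) - ((0 : ℕ) : ℝ)) * (s / 3)
      rw [c3k]; push_cast
      exact ⟨by linarith, by linarith⟩
    · show s / 4 ≤ x ∧ s * k ≤ 2 * ((0 : ℕ) : ℝ) + (((4 * k : ℕ) : ℝ) - ((0 : ℕ) : ℝ)) * x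
      rw [c4k, hx]; push_cast
      exact ⟨le_rfl, by linarith⟩
    · show s / 4 ≤ 1 ∧ s * k ≤ 2 * (k : ℝ) + ((k : ℝ) - k) * 1
      exact ⟨by linarith, by linarith⟩
    · show s / 4 ≤ 1 ∧ s * k ≤ 2 * ((2 * k : ℕ) : ℝ) + (((2 * k : ℕ) : ℝ) - ((2 * k : ℕ) : ℝ)) * 1
      rw [c2k]
      exact ⟨by linarith, by linarith⟩
    · show s / 4 ≤ 1 ∧ s * k ≤ 2 * ((3 * k : ℕ) : ℝ) + (((3 * k : ℕ) : ℝ) - ((3 * k : ℕ) : ℝ)) * 1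
      rw [c3k]
      exact ⟨by linarith, by linarith⟩
    · show s / 4 ≤ 1 ∧ s * k ≤ 2 * ((4 * k : ℕ) : ℝ) + (((4 * k : ℕ) : ℝ) - ((4 * k : ℕ) : ℝ)) * 1
      rw [c4k]
      exact ⟨by linarith, by linarith⟩

end LawDec
end Quant
end Summit.CriticalPhenomena.PercolationContinuityZ3.Theorems
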